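import Summits.CriticalPhenomena.PercolationContinuityZ3.Theorems.Transplant.SkelSign2ParamsAtQ2
import Summits.CriticalPhenomena.PercolationContinuityZ3.Theorems.Transplant.SkelSign2ParamsDepth
import Summits.CriticalPhenomena.PercolationContinuityZ3.Theorems.Transplant.SkelSign2ParamsCounts
import Summits.CriticalPhenomena.PercolationContinuityZ3.Theorems.Transplant.SkelSign2ParamsWidths
import Summits.CriticalPhenomena.PercolationContinuityZ3.Theorems.Transplant.KNCells2ChainBandRO
import Summits.CriticalPhenomena.PercolationContinuityZ3.Theorems.Transplant.KNCells2ChainLocaliseS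
import HarnessLib

/-!
# D″ L7′ params, part 11: THE (C) CORRIDOR VALUES of `signChoice₂` and their records (p5-g6's division of labour 06:58Z; binder list =
# `Skelφ.reachOblRH_of_stepI_corrR`, SIGN-PARAMS.md §9): per run axis `a` (`∥ := a`, `⊥ := oth a`) — over the clamped band widths `WbC` and their bound
# `WMC` (values and `widths_at` in `SkelSign2ParamsWidths`, imported; lead ruling 2026-08-21T08:21:49Z), phase 1 (Loc along `⊥` from `L₁₀ := 3 r⊥`, `W₁₀ := 3 r∥`, rounds `NC₁`), phase 2 (Loc along `∥` from `L₂₀ := Loc.W W₁₀ R′ WMC⊥ (NC₁+1)`,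
# `W₂₀ := Loc.L L₁₀ R′ ℓ₀⊥ ℓtop⊥ (NC₁+1) = ℓ₀⊥`, rounds `NC₂`), phase 3 (ROOTED band along `∥`: `qq := Loc.L L₂₀ R′ ℓ₀∥ ℓtop∥ (NC₂+1) = ℓ₀∥`,
# `q′C := Loc.W W₂₀ R′ WMC∥ (NC₂+1)`, stride `sC∥`, far lines `NC₃`, TRANSVERSE `ρC := q′C + (NC₃+1)R′ + 2·WMC∥`, back room `ρ₀C := 3qq + sC + 2R′`) —
# with the two `Loc.LocOK` records, the `Band.BandOKR` record (F-DP4-2 file of record, p253183), `hℓ₁₃ : 2qq + sC + R′ ≤ ℓtop∥`, the joins by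
# `rfl`, the closed forms `W₂₀ = ℓ₀⊥`, `qq = ℓ₀∥`, and the rooms `hL hW hρ₀ hfar h17` (the `Loc.W`-rooms `h₁L h₁W h₂L h₂W hρ₂ hw` are part 12)

builds on p205010 (kernel theorem, internal audit signed; external expert review pending) — nothing in this file uses p205010.
Lane `prim-bschramm-*`, seat `prim-bschramm-stmt` (gen 9); helper file (`--supports stmt-CriticalPhenomena-4575`).  p5-g6 assembles `Corr.CorrROK`
from `corr_loc₁_at`, `corr_loc₂_at`, `corr_band_at`, `corr_hℓ₁₃_at` and the four `rfl` joins, and writes `reachHoldsRHFn_signChoice₂`.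
[cite: KozmaNitzan2024, §4 Lemma 12 (pp. 23–25), Theorem 6 Step IV (p. 30)]
-/

noncomputable section

open scoped Classical

namespace Summit.CriticalPhenomena.PercolationContinuityZ3.Theorems.Transplant

namespace PlanarSkeletonSign

namespace Sgn₂

open Literature.Probability.Percolation Literature.Probability.LatticeModels SimpleGraph
open Literature.Probability.Percolation.KozmaNitzan.Cells (oth oth_oth)
open SkelConc (Consts)
open Sgn (K a A L twenty_le_K one_le_a hundred_le_A K_le_A five_le_L sixteen_L_le_A δkit δI m₀ Mu ρz M T₀ Kd Rseed rs cU sB B kP NP Lcnt Rlev R' η reachK Sz L_hyps)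
open ChainPlanar

section Defs

variable (κ : Consts) {V : Type} [DecidableEq V] [Countable V] {G : SimpleGraph V} [G.LocallyFinite] (Φ : PlanarSkeletonSign G)
  (p : unitInterval) (O : Skelφ.StepI.Out V) (a : Fin 2)

/-- Phase 1 start: the along-width `L₁₀ := 3 r⊥` (the `M` box, axis `⊥`). [this work] -/
def L₁₀ : ℤ := 3 * ((cells κ Φ p O).r (oth a) : ℤ)

/-- Phase 1 start: the transverse width `W₁₀ := 3 r∥`. [this work] -/
def W₁₀ : ℤ := 3 * ((cells κ Φ p O).r a : ℤ)

/-- Phase 2 start along-width `L₂₀ := Loc.W W₁₀ R′ WMC⊥ (NC₁+1)` (join 1). [this work] -/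
def L₂₀ : ℤ := Loc.W (W₁₀ κ Φ p O a) (R' κ Φ p O) (WMC κ Φ p O (oth a)) (NC₁ κ Φ p O a + 1)

/-- Phase 2 start transverse width `W₂₀ := Loc.L L₁₀ R′ ℓ₀⊥ ℓtop⊥ (NC₁+1)` (join 1; `= ℓ₀⊥`). [this work] -/
def W₂₀ : ℤ := Loc.L (L₁₀ κ Φ p O a) (R' κ Φ p O) (ℓ₀ κ Φ p O (oth a)) (ℓtop κ Φ p O (oth a)) (NC₁ κ Φ p O a + 1)

/-- Phase 3 start half-length `qq := Loc.L L₂₀ R′ ℓ₀∥ ℓtop∥ (NC₂+1)` (join 2; `= ℓ₀∥`). [this work] -/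
def qq : ℤ := Loc.L (L₂₀ κ Φ p O a) (R' κ Φ p O) (ℓ₀ κ Φ p O a) (ℓtop κ Φ p O a) (NC₂ κ Φ p O a + 1)

/-- Phase 3 start half-width `q′C := Loc.W W₂₀ R′ WMC∥ (NC₂+1)` (join 2). [this work] -/
def q'C : ℤ := Loc.W (W₂₀ κ Φ p O a) (R' κ Φ p O) (WMC κ Φ p O a) (NC₂ κ Φ p O a + 1)

/-- **The TRANSVERSE half-width of the band** `ρC := q′C + (NC₃+1)R′ + 2·WMC∥` (F-DP4-2: transverse only). [this work] -/
def ρC : ℤ := q'C κ Φ p O a + ((NC₃ κ Φ p O a : ℤ) + 1) * (R' κ Φ p O : ℤ) + 2 * (WMC κ Φ p O a : ℤ)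

/-- The band's backward extent `ρ₀C := 3qq + sC + 2R′` (`= (L+1)e∥ − R′`). [this work] -/
def ρ₀C : ℤ := 3 * qq κ Φ p O a + (sC κ Φ p O a : ℤ) + 2 * (R' κ Φ p O : ℤ)

end Defs

section AtQ

variable {κ : Consts} {V : Type} [DecidableEq V] [Countable V] {G : SimpleGraph V} [G.LocallyFinite] {Φ : PlanarSkeletonSign G}
  {t : V} {p : unitInterval} {hC : Φ.CylSubcritical p} {O : Skelφ.StepI.Out V} {q : unitInterval}
  (hat : (choiceAt κ Φ t p hC).AtQ O q)
include hat

/-! ## §1 Widths -/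

/-! ## §2 Phase 1 and phase 2: the two `LocOK` records and the closed forms of the joins -/

/-- **Phase 1 is admissible**: `Loc.LocOK L₁₀ W₁₀ R′ ℓ₀⊥ ℓtop⊥ WMC⊥ WbC⊥`. [folklore] -/
theorem corr_loc₁_at (a : Fin 2) : Loc.LocOK (L₁₀ κ Φ p O a) (W₁₀ κ Φ p O a) (R' κ Φ p O) (ℓ₀ κ Φ p O (oth a)) (ℓtop κ Φ p O (oth a))
    (WMC κ Φ p O (oth a)) (WbC κ Φ p O (oth a)) := by
  have hb := extents_le_at hat (oth a)
  have hs := strides_at hat (oth a)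
  refine ⟨by unfold L₁₀; positivity, by unfold W₁₀; positivity, hb.1.trans (hb.2.1.trans hb.2.2.1), by omega, (widths_at hat (oth a)).1⟩

/-- **Phase 1 reaches**: `W₂₀ = ℓ₀⊥` (`Loc.L_eq_ℓ₀` + `loc₁_reach`). [folklore] -/
theorem W₂₀_eq (a : Fin 2) : W₂₀ κ Φ p O a = ℓ₀ κ Φ p O (oth a) := by
  have hs := strides_at hat (oth a)
  have hr := loc₁_reach hat a
  unfold W₂₀ L₁₀
  refine Loc.L_eq_ℓ₀ _ _ _ _ (by omega) (by omega) ?_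
  have hsub : ((ℓtop κ Φ p O (oth a) : ℤ) - R' κ Φ p O) = ((ℓtop κ Φ p O (oth a) - R' κ Φ p O : ℕ) : ℤ) := by omega
  rw [hsub]; exact_mod_cast hr

/-- **Phase 2 is admissible**: `Loc.LocOK L₂₀ W₂₀ R′ ℓ₀∥ ℓtop∥ WMC∥ WbC∥`. [folklore] -/
theorem corr_loc₂_at (a : Fin 2) : Loc.LocOK (L₂₀ κ Φ p O a) (W₂₀ κ Φ p O a) (R' κ Φ p O) (ℓ₀ κ Φ p O a) (ℓtop κ Φ p O a)
    (WMC κ Φ p O a) (WbC κ Φ p O a) := by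
  have hb := extents_le_at hat a
  have hs := strides_at hat a
  have hW : 0 ≤ L₂₀ κ Φ p O a := by
    unfold L₂₀
    have := (Loc.W_mono_facts (W₁₀ κ Φ p O a) (R' κ Φ p O) (WMC κ Φ p O (oth a)) (NC₁ κ Φ p O a + 1)).1
    have h0 : (0 : ℤ) ≤ W₁₀ κ Φ p O a := by unfold W₁₀; positivity
    linarith
  refine ⟨hW, by rw [W₂₀_eq hat a]; positivity, hb.1.trans (hb.2.1.trans hb.2.2.1), by omega, (widths_at hat a).1⟩

/-- **Phase 2 reaches**: `qq = ℓ₀∥` (`Loc.L_eq_ℓ₀` + `loc₂_reach`, using `L₂₀ ≤ 3 r∥ + (NC₁+1)R′` from `Loc.W_succ_eq_max` and `WMC⊥ ≤ 3 r∥`). [folklore] -/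
theorem qq_eq (a : Fin 2) : qq κ Φ p O a = ℓ₀ κ Φ p O a := by
  have hs := strides_at hat a
  have hr := loc₂_reach hat a
  have hw := (widths_at hat (oth a)).2.2
  rw [oth_oth] at hw
  -- `L₂₀ = W (NC₁+1) = max (3r∥ + (NC₁+1)R′) (WMC⊥ + NC₁ R′) = 3 r∥ + (NC₁+1) R′`
  have hL : L₂₀ κ Φ p O a ≤ 3 * ((cells κ Φ p O).r a : ℤ) + ((NC₁ κ Φ p O a : ℤ) + 1) * R' κ Φ p O := by
    unfold L₂₀ W₁₀
    rw [Loc.W_succ_eq_max]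
    refine max_le le_rfl ?_
    have : ((WMC κ Φ p O (oth a) : ℕ) : ℤ) ≤ 3 * ((cells κ Φ p O).r a : ℤ) := by exact_mod_cast (show WMC κ Φ p O (oth a) ≤ 3 * (cells κ Φ p O).r a by omega)
    nlinarith
  unfold qq
  refine Loc.L_eq_ℓ₀ _ _ _ _ (by omega) (by omega) ?_
  have hsub : ((ℓtop κ Φ p O a : ℤ) - R' κ Φ p O) = ((ℓtop κ Φ p O a - R' κ Φ p O : ℕ) : ℤ) := by omega
  rw [hsub]
  have hr' : ((3 * (cells κ Φ p O).r a + (NC₁ κ Φ p O a + 1) * R' κ Φ p O : ℕ) : ℤ) ≤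
      (((NC₂ κ Φ p O a + 1) * (ℓtop κ Φ p O a - R' κ Φ p O) + ℓ₀ κ Φ p O a : ℕ) : ℤ) := by exact_mod_cast hr
  push_cast at hr' ⊢
  linarith

/-! ## §3 Phase 3: the rooted band record, the certified extent, the back room -/

/-- **Phase 3 is admissible** (`Band.BandOKR`, file of record p253183): `0 ≤ qq`, `0 ≤ q′C`, `R′ + ℓ₀∥ ≤ sC`, `2R′ ≤ sC`, `q′C + (NC₃+1)R′ + 2WMC ≤ ρC`
(equality), `∀ ℓ ≤ 2qq + sC + R′, WbC ℓ ≤ WMC`. [folklore] -/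
theorem corr_band_at (a : Fin 2) : Band.BandOKR (qq κ Φ p O a) (q'C κ Φ p O a) (sC κ Φ p O a) (ρC κ Φ p O a) (R' κ Φ p O)
    (ℓ₀ κ Φ p O a) (NC₃ κ Φ p O a) (WMC κ Φ p O a) (WbC κ Φ p O a) := by
  have hs := strides_at hat a
  have hq := qq_eq hat a
  have hW2 := W₂₀_eq hat a
  have hq' : 0 ≤ q'C κ Φ p O a := by
    unfold q'C; rw [hW2]
    have := (Loc.W_mono_facts (ℓ₀ κ Φ p O (oth a) : ℤ) (R' κ Φ p O) (WMC κ Φ p O a) (NC₂ κ Φ p O a + 1)).1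
    linarith [show (0 : ℤ) ≤ ℓ₀ κ Φ p O (oth a) by positivity]
  refine ⟨by rw [hq]; positivity, hq', by rw [← Nat.cast_add]; exact_mod_cast hs.2.2.2.2.2.1, by exact_mod_cast hs.2.2.2.2.2.2.2.2,
    by unfold ρC; exact le_rfl, fun ℓ hℓ => (widths_at hat a).1 ℓ ?_⟩
  rw [hq] at hℓ
  have h3 := hs.2.2.1
  omega

/-- **The band's extents are certified up to `ℓtop∥`**: `2qq + sC + R′ ≤ ℓtop∥` (equality). [folklore] -/
theorem corr_hℓ₁₃_at (a : Fin 2) : 2 * qq κ Φ p O a + sC κ Φ p O a + R' κ Φ p O ≤ (ℓtop κ Φ p O a : ℤ) := by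
  rw [qq_eq hat a]
  have h3 := (strides_at hat a).2.2.1
  omega

omit hat in
/-- The four joins hold by `rfl`: `L₂₀`, `W₂₀`, `qq`, `q′C` are the `Loc.W`/`Loc.L` terms of `CorrROK.hL₂/hW₂/hq/hq'`. [folklore] -/
theorem corr_joins_at (a : Fin 2) :
    L₂₀ κ Φ p O a = Loc.W (W₁₀ κ Φ p O a) (R' κ Φ p O) (WMC κ Φ p O (oth a)) (NC₁ κ Φ p O a + 1) ∧
    W₂₀ κ Φ p O a = Loc.L (L₁₀ κ Φ p O a) (R' κ Φ p O) (ℓ₀ κ Φ p O (oth a)) (ℓtop κ Φ p O (oth a)) (NC₁ κ Φ p O a + 1) ∧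
    qq κ Φ p O a = Loc.L (L₂₀ κ Φ p O a) (R' κ Φ p O) (ℓ₀ κ Φ p O a) (ℓtop κ Φ p O a) (NC₂ κ Φ p O a + 1) ∧
    q'C κ Φ p O a = Loc.W (W₂₀ κ Φ p O a) (R' κ Φ p O) (WMC κ Φ p O a) (NC₂ κ Φ p O a + 1) := ⟨rfl, rfl, rfl, rfl⟩

/-- **Start box and far lines**: `hL : L₁₀ = 3 r⊥`, `hW : W₁₀ = 3 r∥` (rfl), the back room `hρ₀ : 3qq + sC + 2R′ ≤ 5 r∥` (indeed `= (L+1)e∥ − R′ ≤ r∥`),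
and `h17 : 17 r∥ ≤ qq + (NC₃+1)·sC`, `hfar : qq + (NC₃+1)·sC ≤ 22 r∥`. [folklore] -/
theorem corr_rooms₁_at (a : Fin 2) : L₁₀ κ Φ p O a = 3 * ((cells κ Φ p O).r (oth a) : ℤ) ∧ W₁₀ κ Φ p O a = 3 * ((cells κ Φ p O).r a : ℤ) ∧
    3 * qq κ Φ p O a + sC κ Φ p O a + 2 * R' κ Φ p O ≤ 5 * ((cells κ Φ p O).r a : ℤ) ∧
    17 * ((cells κ Φ p O).r a : ℤ) ≤ qq κ Φ p O a + ((NC₃ κ Φ p O a : ℤ) + 1) * sC κ Φ p O a ∧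
    qq κ Φ p O a + ((NC₃ κ Φ p O a : ℤ) + 1) * sC κ Φ p O a ≤ 22 * ((cells κ Φ p O).r a : ℤ) := by
  have hq := qq_eq hat a
  have hbr := band_reach hat a
  have hs := strides_at hat a
  have hr := cells_r_at hat a
  have hA := hundred_le_A κ
  have hLA : L κ + 1 ≤ A κ := by have := (sixteen_L_le_A κ).2; omega
  -- `3ℓ₀ + sC + 2R′ = (L+1)e − R′ ≤ A e = r`
  have hρ0 : 3 * ℓ₀ κ Φ p O a + sC κ Φ p O a + 2 * R' κ Φ p O ≤ (cells κ Φ p O).r a := by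
    have h3 := hs.2.2.1  -- 2ℓ₀ + sC + R′ = L e
    have h0 := (extents_eq_at hat a).1  -- ℓ₀ + R′ = e
    rw [hr]
    have : (L κ + 1) * e κ Φ p O a ≤ A κ * e κ Φ p O a := Nat.mul_le_mul_right _ hLA
    unfold ℓtop at h3; nlinarith
  refine ⟨rfl, rfl, ?_, ?_, ?_⟩
  · rw [hq]; exact_mod_cast (show 3 * ℓ₀ κ Φ p O a + sC κ Φ p O a + 2 * R' κ Φ p O ≤ 5 * (cells κ Φ p O).r a by omega)
  · rw [hq]; exact_mod_cast hbr.1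
  · rw [hq]; exact_mod_cast hbr.2

/-- Route rooms of the (C) kit calls on the merged range: `hMℓ : Mu + 1 ≤ min (min ℓ₀⊥ ℓ₀∥) ℓ₀∥`, `hSx/hSy` (merged range in both lists), and the widths
dominate on every phase's range (`hWr`). [folklore] -/
theorem corr_route_at (a : Fin 2) : Mu O + 1 ≤ min (min (ℓ₀ κ Φ p O (oth a)) (ℓ₀ κ Φ p O a)) (ℓ₀ κ Φ p O a) ∧
    (∀ ℓ, Smin κ Φ p O ≤ ℓ → ℓ ≤ Smax κ Φ p O → ℓ ∈ Sx κ Φ p O ∧ ℓ ∈ Sy κ Φ p O) ∧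
    (∀ i ℓ, ℓ₀ κ Φ p O i ≤ ℓ → Skelφ.StepI.widths O.D.Gb O.D.Fb i ℓ (oth i) ≤ WbC κ Φ p O i ℓ) :=
  ⟨le_min (le_min (Mu_succ_le_ℓ₀_at hat (oth a)).1 (Mu_succ_le_ℓ₀_at hat a).1) (Mu_succ_le_ℓ₀_at hat a).1,
    fun _ h₀ h₁ => mem_lists_of_Icc (κ := κ) h₀ h₁, fun i ℓ hℓ => (widths_at hat i).2.1 ℓ hℓ⟩

/-! ## §4 The nine rooms of `reachOblRH_of_stepI_corrR` (p5-g6): `h₁L h₁W h₂L h₂W hρ₂ hw` (the other three are `corr_rooms₁_at`), the merged-range widths -/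

/-- The arithmetic behind the rooms, in `ℕ`: `(NC₁+1)R′ + R′ + WMC⊥ ≤ r∥`, `(NC₁+1)R′ + R′ + ℓtop∥ ≤ 2 r∥`, `R′ + ℓtop⊥ ≤ 2 r⊥`, `ℓ₀ ≤ 3 r` (both axes),
`ℓ₀⊥ + 3·WMC∥ + (NC₂+1)R′ + (NC₃+1)R′ + R′ ≤ r⊥`. [folklore] -/
theorem corr_rooms_nat_at (a : Fin 2) : (NC₁ κ Φ p O a + 1) * R' κ Φ p O + R' κ Φ p O + WMC κ Φ p O (oth a) ≤ (cells κ Φ p O).r a ∧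
    (NC₁ κ Φ p O a + 1) * R' κ Φ p O + R' κ Φ p O + ℓtop κ Φ p O a ≤ 2 * (cells κ Φ p O).r a ∧
    R' κ Φ p O + ℓtop κ Φ p O (oth a) ≤ 2 * (cells κ Φ p O).r (oth a) ∧ ℓ₀ κ Φ p O (oth a) ≤ 3 * (cells κ Φ p O).r (oth a) ∧
    ℓ₀ κ Φ p O a ≤ 3 * (cells κ Φ p O).r a ∧
    ℓ₀ κ Φ p O (oth a) + 3 * WMC κ Φ p O a + (NC₂ κ Φ p O a + 1) * R' κ Φ p O + (NC₃ κ Φ p O a + 1) * R' κ Φ p O + R' κ Φ p O ≤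
      (cells κ Φ p O).r (oth a) := by
  obtain ⟨hc1, hc2, hc3⟩ := counts_le hat a
  obtain ⟨-, -, hℓr, -, hRe, hr⟩ := count_units_at hat a
  obtain ⟨-, -, hℓro, -, hReo, hro⟩ := count_units_at hat (oth a)
  have hW := (widths_at hat a).2.2
  have hWo := (widths_at hat (oth a)).2.2
  rw [oth_oth] at hWo
  have hA := hundred_le_A κ
  have hLA : L κ + 1 ≤ A κ := by have := (sixteen_L_le_A κ).2; omega
  have h0o := (extents_le_at hat (oth a)).1
  have h1 : (NC₁ κ Φ p O a + 1) * R' κ Φ p O ≤ 61 * R' κ Φ p O := Nat.mul_le_mul_right _ (by omega)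
  have h2 : (NC₂ κ Φ p O a + 1) * R' κ Φ p O ≤ 62 * R' κ Φ p O := Nat.mul_le_mul_right _ (by omega)
  have h3 : (NC₃ κ Φ p O a + 1) * R' κ Φ p O ≤ 579 * R' κ Φ p O := Nat.mul_le_mul_right _ (by omega)
  have he : 100 * e κ Φ p O a ≤ (cells κ Φ p O).r a := by rw [hr]; exact Nat.mul_le_mul_right _ hA
  have heo : 100 * e κ Φ p O (oth a) ≤ (cells κ Φ p O).r (oth a) := by rw [hro]; exact Nat.mul_le_mul_right _ hA
  have ht : ℓtop κ Φ p O a + e κ Φ p O a ≤ (cells κ Φ p O).r a := by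
    have := Nat.mul_le_mul_right (e κ Φ p O a) hLA
    rw [hr]; unfold ℓtop; simpa [Nat.add_mul] using this
  have hto : ℓtop κ Φ p O (oth a) + e κ Φ p O (oth a) ≤ (cells κ Φ p O).r (oth a) := by
    have := Nat.mul_le_mul_right (e κ Φ p O (oth a)) hLA
    rw [hro]; unfold ℓtop; simpa [Nat.add_mul] using this
  refine ⟨by omega, by omega, by omega, by omega, by omega, by omega⟩

/-- **The six remaining rooms of `reachOblRH_of_stepI_corrR`**: `h₁L : max L₁₀ ℓ₀⊥ + R′ + ℓtop⊥ ≤ 5 r⊥`, `h₁W : Loc.W W₁₀ R′ WMC⊥ (NC₁+1) + R′ + WMC⊥ ≤ 5 r∥`,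
`h₂L : max L₂₀ ℓ₀∥ + R′ + ℓtop∥ ≤ 5 r∥`, `h₂W : Loc.W W₂₀ R′ WMC∥ (NC₂+1) + R′ + WMC∥ ≤ 5 r⊥`, `hρ₂ : ρC ≤ 2 r⊥`, `hw : w₁ q′C R′ WMC∥ + NC₃ R′ ≤ 2 r⊥`.
[folklore] -/
theorem corr_rooms₂_at (a : Fin 2) :
    max (L₁₀ κ Φ p O a) (ℓ₀ κ Φ p O (oth a) : ℤ) + R' κ Φ p O + ℓtop κ Φ p O (oth a) ≤ 5 * ((cells κ Φ p O).r (oth a) : ℤ) ∧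
    Loc.W (W₁₀ κ Φ p O a) (R' κ Φ p O) (WMC κ Φ p O (oth a)) (NC₁ κ Φ p O a + 1) + R' κ Φ p O + WMC κ Φ p O (oth a) ≤ 5 * ((cells κ Φ p O).r a : ℤ) ∧
    max (L₂₀ κ Φ p O a) (ℓ₀ κ Φ p O a : ℤ) + R' κ Φ p O + ℓtop κ Φ p O a ≤ 5 * ((cells κ Φ p O).r a : ℤ) ∧
    Loc.W (W₂₀ κ Φ p O a) (R' κ Φ p O) (WMC κ Φ p O a) (NC₂ κ Φ p O a + 1) + R' κ Φ p O + WMC κ Φ p O a ≤ 5 * ((cells κ Φ p O).r (oth a) : ℤ) ∧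
    ρC κ Φ p O a ≤ 2 * ((cells κ Φ p O).r (oth a) : ℤ) ∧
    Band.w₁ (q'C κ Φ p O a) (R' κ Φ p O) (WMC κ Φ p O a) + (NC₃ κ Φ p O a : ℤ) * R' κ Φ p O ≤ 2 * ((cells κ Φ p O).r (oth a) : ℤ) := by
  obtain ⟨n1, n2, n3, n4, n5, n6⟩ := corr_rooms_nat_at hat a
  have hW2 := W₂₀_eq hat a
  have hWMo : (WMC κ Φ p O (oth a) : ℤ) ≤ W₁₀ κ Φ p O a := by
    have := (widths_at hat (oth a)).2.2; rw [oth_oth] at this; unfold W₁₀; omega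
  have hWeq : Loc.W (W₁₀ κ Φ p O a) (R' κ Φ p O) (WMC κ Φ p O (oth a)) (NC₁ κ Φ p O a + 1) =
      3 * ((cells κ Φ p O).r a : ℤ) + ((NC₁ κ Φ p O a : ℤ) + 1) * R' κ Φ p O := by
    rw [Loc.W_eq _ _ _ hWMo]; unfold W₁₀; push_cast; ring
  have hL₂ : L₂₀ κ Φ p O a = 3 * ((cells κ Φ p O).r a : ℤ) + ((NC₁ κ Φ p O a : ℤ) + 1) * R' κ Φ p O := hWeq
  have z1 : ((NC₁ κ Φ p O a : ℤ) + 1) * R' κ Φ p O + R' κ Φ p O + WMC κ Φ p O (oth a) ≤ (cells κ Φ p O).r a := by exact_mod_cast n1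
  have z2 : ((NC₁ κ Φ p O a : ℤ) + 1) * R' κ Φ p O + R' κ Φ p O + ℓtop κ Φ p O a ≤ 2 * (cells κ Φ p O).r a := by exact_mod_cast n2
  have z3 : (R' κ Φ p O : ℤ) + ℓtop κ Φ p O (oth a) ≤ 2 * (cells κ Φ p O).r (oth a) := by exact_mod_cast n3
  have z4 : (ℓ₀ κ Φ p O (oth a) : ℤ) ≤ 3 * (cells κ Φ p O).r (oth a) := by exact_mod_cast n4
  have z5 : (ℓ₀ κ Φ p O a : ℤ) ≤ 3 * (cells κ Φ p O).r a := by exact_mod_cast n5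
  have z6 : (ℓ₀ κ Φ p O (oth a) : ℤ) + 3 * WMC κ Φ p O a + ((NC₂ κ Φ p O a : ℤ) + 1) * R' κ Φ p O + ((NC₃ κ Φ p O a : ℤ) + 1) * R' κ Φ p O +
      R' κ Φ p O ≤ (cells κ Φ p O).r (oth a) := by exact_mod_cast n6
  have hR0 : (0 : ℤ) ≤ R' κ Φ p O := Int.natCast_nonneg _
  have hWM0 : (0 : ℤ) ≤ WMC κ Φ p O a := Int.natCast_nonneg _
  have hℓ0 : (0 : ℤ) ≤ ℓ₀ κ Φ p O (oth a) := Int.natCast_nonneg _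
  have p1 : (0 : ℤ) ≤ ((NC₁ κ Φ p O a : ℤ) + 1) * R' κ Φ p O := by positivity
  have p3 : (0 : ℤ) ≤ ((NC₃ κ Φ p O a : ℤ) + 1) * R' κ Φ p O := by positivity
  have zC : (NC₃ κ Φ p O a : ℤ) * R' κ Φ p O ≤ ((NC₃ κ Φ p O a : ℤ) + 1) * R' κ Φ p O := mul_le_mul_of_nonneg_right (by linarith) hR0
  have zD : (NC₂ κ Φ p O a : ℤ) * R' κ Φ p O ≤ ((NC₂ κ Φ p O a : ℤ) + 1) * R' κ Φ p O := mul_le_mul_of_nonneg_right (by linarith) hR0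
  -- the phase-2 width and the band's first width: `Loc.W ℓ₀⊥ R′ WMC∥ (NC₂+1) ≤ ℓ₀⊥ + WMC∥ + (NC₂+1)R′`
  have hWq : Loc.W (W₂₀ κ Φ p O a) (R' κ Φ p O) (WMC κ Φ p O a) (NC₂ κ Φ p O a + 1) ≤
      (ℓ₀ κ Φ p O (oth a) : ℤ) + WMC κ Φ p O a + ((NC₂ κ Φ p O a : ℤ) + 1) * R' κ Φ p O := by
    rw [Loc.W_succ_eq_max, hW2]
    exact max_le (by linarith) (by linarith)
  have hq' : q'C κ Φ p O a ≤ (ℓ₀ κ Φ p O (oth a) : ℤ) + WMC κ Φ p O a + ((NC₂ κ Φ p O a : ℤ) + 1) * R' κ Φ p O := hWq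
  refine ⟨?_, ?_, ?_, ?_, ?_, ?_⟩
  · have hL : L₁₀ κ Φ p O a = 3 * ((cells κ Φ p O).r (oth a) : ℤ) := rfl
    rw [max_eq_left (by rw [hL]; linarith), hL]; linarith
  · rw [hWeq]; linarith
  · rw [max_eq_left (by rw [hL₂]; linarith), hL₂]; linarith
  · linarith
  · show q'C κ Φ p O a + ((NC₃ κ Φ p O a : ℤ) + 1) * (R' κ Φ p O : ℤ) + 2 * (WMC κ Φ p O a : ℤ) ≤ _
    linarith
  · unfold Band.w₁; linarith

/-- **Widths on the merged range** (`hWr₁/hWr₂/hWr₃`): above `D.k`, `widths i ℓ ⊥ ≤ WbC i ℓ` (monotonicity and `ℓ ≤ max ℓ ℓ₀`). [folklore] -/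
theorem corr_widths_merged_at (i : Fin 2) {ℓ : ℕ} (hk : O.D.k ≤ ℓ) : Skelφ.StepI.widths O.D.Gb O.D.Fb i ℓ (oth i) ≤ WbC κ Φ p O i ℓ := by
  unfold WbC; exact widths_oth_mono hat i hk (le_max_left _ _)

/-- The merged extent range of the corridor schedule lies in `[Smin, Smax]` and above `D.k`: `Smin ≤ min (min ℓ₀⊥ ℓ₀∥) ℓ₀∥`,
`max (max ℓtop⊥ ℓtop∥) ℓtop∥ ≤ Smax`, `D.k ≤ Smin`. [folklore] -/
theorem corr_range_at (a : Fin 2) : Smin κ Φ p O ≤ min (min (ℓ₀ κ Φ p O (oth a)) (ℓ₀ κ Φ p O a)) (ℓ₀ κ Φ p O a) ∧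
    max (max (ℓtop κ Φ p O (oth a)) (ℓtop κ Φ p O a)) (ℓtop κ Φ p O a) ≤ Smax κ Φ p O ∧ O.D.k ≤ Smin κ Φ p O := by
  have h := Smin_Smax_at hat a
  have ho := Smin_Smax_at hat (oth a)
  exact ⟨le_min (le_min ho.1 h.1) h.1, max_le (max_le ho.2.1 h.2.1) h.2.1, h.2.2.2⟩

end AtQ

end Sgn₂

end PlanarSkeletonSign

end Summit.CriticalPhenomena.PercolationContinuityZ3.Theorems.Transplant

end
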